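import Mathlib
import Summits.RiemannHypothesis.RiemannHypothesis.Theorems.WeilGroundStateGroundStatesConvergeToXiEulerLagrange
import Summits.RiemannHypothesis.RiemannHypothesis.Theorems.WeilGroundStateGroundStatesConvergeToXiEnergyBddBelow
import Summits.RiemannHypothesis.RiemannHypothesis.Theorems.WeilGroundStateGroundStatesConvergeToXiUniformBound
import Summits.RiemannHypothesis.RiemannHypothesis.Theorems.WeilGroundStateGroundStatesConvergeToXiWeightedL1
import Summits.RiemannHypothesis.RiemannHypothesis.Theorems.GronwallLeakage.Negative.LoadBearing
import Literature.NumberTheory.LFunctions.WeilExplicit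
import Literature.NumberTheory.LFunctions.WeilGroundEnergyProofs
import Literature.NumberTheory.LFunctions.WeilGroundState
import Literature.NumberTheory.LFunctions.RiemannXiFourier
import HarnessLib

/-!
# RH from non-degenerate tight ground states — formal RH-hardness of `stub_tightWeakLimit`
(crux item stmt-RiemannHypothesis-1527 `GroundStatesConvergeToXi`, route
route-RiemannHypothesis-WeilGroundState, line `Sketch`; `--supports`)

The line reduces the crux to the position-space statement C⁺ (`stub_tightWeakLimit`): along
some windows `a_k → ∞` the renormalised operator-free Weil ground states `c_k u_k` are tight in
every weighted `L¹(e^{b|t|})`, `b < 1/2`, and converge weakly to Riemann's kernel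
`Φ(t) = 2Ψ(2t)`.  This file proves that the `b₀ > 1/2` strengthening of such a statement is
already **RH-strong**, without simplicity/evenness of the bottom, without Connes–van Suijlekom
and without Hurwitz:

* `riemannHypothesis_of_nondegenerate_tight_groundStates` — if along windows `a_k → ∞` there are
  ground states `u_k` and scalars `c_k` with `c_k u_k` bounded in ONE weighted `L¹(e^{b₀|t|})`,
  `b₀ > 1/2`, and ONE test function `h₀` with `‖⟨c_k u_k, h₀⟩‖ ≥ η > 0` for all `k`, then RH.
  Mechanism: the weak Euler–Lagrange equation (`groundState_eulerLagrange`,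
  `…EulerLagrange.lean`) and the uniform weighted bound `‖W(f ⋆ h̃₀)‖ ≤ C ∫|f|e^{b₀|t|}`
  (`norm_weilFunctional_weilConv_weilReflect_le`, `…UniformBound.lean`; `1/2` is the threshold:
  the prime sum needs `Σ Λ(n) n^{-1/2-b₀} < ∞`) give `|ε(a_k)| ≤ C M / η`; the ground energy is
  non-increasing in the window (`weilGroundEnergy_antitone_of_pos`, tree), so it is bounded below, and
  `ε` bounded below already implies RH (`riemannHypothesis_of_weilGroundEnergy_bddBelow`,
  `…EnergyBddBelow.lean`, a strengthening of the converse half of Weil's criterion).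
* `riemannHypothesis_of_tightWeakLimit_strong` — C⁺⁺ ⇒ RH: tightness in one `L¹(e^{b₀|t|})`,
  `b₀ > 1/2`, plus weak convergence to `Φ` against test functions implies RH (a bump `h₀` at `0`
  has `∫ Φ h₀ > 0` since `Ψ(0) > 0`).

Contrapositive ("total escape of mass"): under ¬RH every `b₀ > 1/2`-tight renormalised sequence
of ground states on windows `a_k → ∞` is weakly null.  So the last open stub of the line is
RH-complete in the precise sense: C⁺⁺ ⇒ RH (this file) and C⁺ ⇒ crux (`…Transfer.lean`), crux ∧
`GroundStateSimpleEven` ⇒ RH (route assembly).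
-/

noncomputable section

set_option linter.dupNamespace false

open scoped Topology Real ComplexConjugate
open Filter Set MeasureTheory Complex

namespace Summit.RiemannHypothesis.RiemannHypothesis.Theorems.GroundStatesConvergeToXi

open Literature.NumberTheory.LFunctions

/-- **RH ⟺ the ground energy is bounded below** (Weil's criterion, sharpened on the converse
side): `RiemannHypothesis ↔ ∃ L, ∀ a > 0, L ≤ ε(a)`.  (`→`: under RH Weil positivity holds,
`WeilPositivity.of_riemannHypothesis explicit_formula_holds`, so `ε(a) ≥ 0` by
`weilGroundEnergy_nonneg_iff_holds`; `←`: `riemannHypothesis_of_weilGroundEnergy_bddBelow`.)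
Since `ε` is non-increasing, this also reads: RH fails iff `ε(a) → -∞` as `a → ∞`. -/
theorem riemannHypothesis_iff_weilGroundEnergy_bddBelow :
    RiemannHypothesis ↔ ∃ L : ℝ, ∀ a : ℝ, 0 < a → L ≤ weilGroundEnergy a := by
  refine ⟨fun hRH => ⟨0, fun a ha => ?_⟩, riemannHypothesis_of_weilGroundEnergy_bddBelow⟩
  have hW : WeilPositivity := WeilPositivity.of_riemannHypothesis explicit_formula_holds hRH
  exact (weilGroundEnergy_nonneg_iff_holds ha).2 fun g hg _ => hW g hg

/-- **RH from non-degenerate tight ground states.**  Suppose that along windows `a_k → ∞` there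
are ground states `u_k` of Weil's truncated form (`IsWeilGroundState (a k) (u k)`) and scalars
`c_k` such that `c_k u_k` is bounded in ONE weighted `L¹(e^{b₀|t|} dt)` with `b₀ > 1/2`, and ONE
test function `h₀` pairs with all of them non-degenerately, `‖∫ c_k u_k h̄₀‖ ≥ η > 0`.  Then the
Riemann hypothesis holds.  Proof: by the weak Euler–Lagrange equation along the minimising
sequence `gₙ` of `u_k` (`groundState_eulerLagrange`), `W(gₙ ⋆ h̃₀) → ε(a_k)⟨u_k, h₀⟩`, while
`‖W(gₙ ⋆ h̃₀)‖ ≤ C ∫|gₙ|e^{b₀|t|} → C ∫|u_k|e^{b₀|t|}` (`norm_weilFunctional_weilConv_weilReflect_le`,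
`tendsto_integral_norm_mul_exp_of_minimizingSeq`); multiplying by `‖c_k‖`,
`|ε(a_k)| η ≤ C ∫|c_k u_k|e^{b₀|t|} ≤ C M`.  As `ε` is non-increasing and `a_k → ∞`, `ε ≥ -CM/η`
on `a > 0`, and `riemannHypothesis_of_weilGroundEnergy_bddBelow` concludes. -/
theorem riemannHypothesis_of_nondegenerate_tight_groundStates
    (h : ∃ a : ℕ → ℝ, ∃ u : ℕ → ℝ → ℂ, ∃ c : ℕ → ℂ, Tendsto a atTop atTop ∧
      (∀ k, IsWeilGroundState (a k) (u k)) ∧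
      (∃ b₀ : ℝ, 1 / 2 < b₀ ∧ ∃ M : ℝ, ∀ k, ∫ t, ‖c k * u k t‖ * Real.exp (b₀ * |t|) ≤ M) ∧
      (∃ h₀ : ℝ → ℂ, IsWeilTest h₀ ∧ ∃ η : ℝ, 0 < η ∧
        ∀ k, η ≤ ‖∫ t, c k * u k t * conj (h₀ t)‖)) :
    RiemannHypothesis := by
  obtain ⟨a, u, c, ha, hu, ⟨b₀, hb₀, M, hM⟩, ⟨h₀, hh₀, η, hη, hηk⟩⟩ := h
  obtain ⟨C, hC0, hC⟩ := norm_weilFunctional_weilConv_weilReflect_le hh₀ hb₀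
  -- a symmetric interval containing the support of `h₀`
  obtain ⟨r, hr⟩ : ∃ r : ℝ, tsupport h₀ ⊆ Icc (-r) r := by
    obtain ⟨R, hR⟩ := hh₀.2.isCompact.isBounded.subset_closedBall 0
    refine ⟨R, fun t ht => ?_⟩
    have := hR ht
    rw [Metric.mem_closedBall, dist_zero_right, Real.norm_eq_abs] at this
    exact ⟨by linarith [neg_abs_le t], le_abs_self t |>.trans this⟩
  apply riemannHypothesis_of_weilGroundEnergy_bddBelow
  refine ⟨-(C * M / η), fun A hA => ?_⟩
  -- a window `a k` beyond `A` and `r`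
  obtain ⟨k, hk⟩ : ∃ k, max A r ≤ a k := (ha.eventually (eventually_ge_atTop _)).exists
  have hAk : A ≤ a k := (le_max_left _ _).trans hk
  have hrk : r ≤ a k := (le_max_right _ _).trans hk
  -- the bound at window `a k`
  have key : |weilGroundEnergy (a k)| * η ≤ C * M := by
    obtain ⟨hu2, g, hg, hQ, hL⟩ := hu k
    have hsupp : tsupport h₀ ⊆ Icc (-(a k)) (a k) :=
      hr.trans (Icc_subset_Icc (neg_le_neg hrk) hrk)
    have hEL := groundState_eulerLagrange hg hQ hu2 hL hh₀ hsupp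
    have hW := tendsto_integral_norm_mul_exp_of_minimizingSeq ⟨hu2, g, hg, hQ, hL⟩ hg hL b₀
    have h1 : ‖(weilGroundEnergy (a k) : ℂ) * ∫ t, u k t * conj (h₀ t)‖ ≤
        C * ∫ t, ‖u k t‖ * Real.exp (b₀ * |t|) :=
      le_of_tendsto_of_tendsto' hEL.norm (hW.const_mul C) fun n => hC (g n) (hg n).1
    have h2 : ‖c k‖ * (C * ∫ t, ‖u k t‖ * Real.exp (b₀ * |t|)) =
        C * ∫ t, ‖c k * u k t‖ * Real.exp (b₀ * |t|) := by
      rw [← integral_const_mul, ← integral_const_mul, ← integral_const_mul]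
      congr 1 with t
      rw [norm_mul]
      ring
    have h3 : ‖c k‖ * ‖(weilGroundEnergy (a k) : ℂ) * ∫ t, u k t * conj (h₀ t)‖ =
        |weilGroundEnergy (a k)| * ‖∫ t, c k * u k t * conj (h₀ t)‖ := by
      have hfun : (fun t => c k * u k t * conj (h₀ t)) = fun t => c k * (u k t * conj (h₀ t)) := by
        funext t; ring
      rw [hfun, integral_const_mul, norm_mul, norm_mul, Complex.norm_real, Real.norm_eq_abs]
      ring
    calc |weilGroundEnergy (a k)| * η
        ≤ |weilGroundEnergy (a k)| * ‖∫ t, c k * u k t * conj (h₀ t)‖ :=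
          mul_le_mul_of_nonneg_left (hηk k) (abs_nonneg _)
      _ = ‖c k‖ * ‖(weilGroundEnergy (a k) : ℂ) * ∫ t, u k t * conj (h₀ t)‖ := h3.symm
      _ ≤ ‖c k‖ * (C * ∫ t, ‖u k t‖ * Real.exp (b₀ * |t|)) :=
          mul_le_mul_of_nonneg_left h1 (norm_nonneg _)
      _ = C * ∫ t, ‖c k * u k t‖ * Real.exp (b₀ * |t|) := h2
      _ ≤ C * M := mul_le_mul_of_nonneg_left (hM k) hC0
  have hεk : -(C * M / η) ≤ weilGroundEnergy (a k) := by
    have : |weilGroundEnergy (a k)| ≤ C * M / η := by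
      rw [le_div_iff₀ hη]
      exact key
    linarith [neg_abs_le (weilGroundEnergy (a k))]
  exact hεk.trans
    (Summit.RiemannHypothesis.Cruxes.GronwallLeakage.Negative.weilGroundEnergy_antitone_of_pos hA hAk)

/-- **A bump pairing positively with Riemann's kernel.**  There is a test function `h₀` (a real,
non-negative smooth bump at `0`, so `conj h₀ = h₀`) with `∫ Φ h₀ ≠ 0`, `Φ(t) = 2Ψ(2t)`: indeed
`Ψ(0) > 0` (`LagariasMontague.Psi_zero_pos`) and `Ψ` is continuous, so `Φ > 0` near `0`. -/
theorem exists_isWeilTest_integral_phi_mul_ne_zero :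
    ∃ h₀ : ℝ → ℂ, IsWeilTest h₀ ∧ (∀ t, conj (h₀ t) = h₀ t) ∧
      (∫ t, 2 * LagariasMontague.Psic (2 * t) * h₀ t) ≠ 0 := by
  -- `Ψ(2t) > 0` for `|t| ≤ δ`
  have hcont : Continuous fun t : ℝ => LagariasMontague.Psi (2 * t) :=
    (LagariasMontague.continuous_thetaSeries _).comp (continuous_const.mul continuous_id)
  have hpos0 : 0 < LagariasMontague.Psi (2 * 0) := by
    rw [mul_zero]; exact LagariasMontague.Psi_zero_pos
  obtain ⟨δ', hδ', hball⟩ := Metric.eventually_nhds_iff.1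
    (hcont.continuousAt.eventually (lt_mem_nhds hpos0))
  set δ : ℝ := δ' / 2 with hδdef
  have hδ : 0 < δ := by positivity
  have hpos : ∀ t : ℝ, |t| ≤ δ → 0 < LagariasMontague.Psi (2 * t) := fun t ht =>
    hball (by rw [dist_zero_right, Real.norm_eq_abs]; linarith)
  -- the bump
  let χ : ContDiffBump (0 : ℝ) := ⟨δ / 2, δ, by positivity, by linarith⟩
  refine ⟨fun t => ((χ t : ℝ) : ℂ), ⟨Complex.ofRealCLM.contDiff.comp χ.contDiff,
    χ.hasCompactSupport.comp_left Complex.ofReal_zero⟩, fun t => Complex.conj_ofReal _, ?_⟩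
  -- the pairing is the integral of a non-negative continuous compactly supported real function
  set f : ℝ → ℝ := fun t => 2 * LagariasMontague.Psi (2 * t) * χ t with hf
  have hfeq : (∫ t, 2 * LagariasMontague.Psic (2 * t) * ((χ t : ℝ) : ℂ)) = ((∫ t, f t : ℝ) : ℂ) := by
    rw [← integral_complex_ofReal]
    congr 1 with t
    simp only [hf, LagariasMontague.Psic]
    push_cast
    ring
  rw [hfeq, Complex.ofReal_ne_zero]
  refine ne_of_gt (Continuous.integral_pos_of_hasCompactSupport_nonneg_nonzero
    ((continuous_const.mul hcont).mul χ.continuous) (χ.hasCompactSupport.mul_left)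
    (fun t => ?_) (x := 0) ?_)
  · -- non-negativity
    simp only [hf, Pi.zero_apply]
    by_cases ht : |t| ≤ δ
    · exact mul_nonneg (mul_nonneg zero_le_two (hpos t ht).le) (χ.nonneg)
    · have hχ0 : χ t = 0 := by
        apply χ.zero_of_le_dist
        rw [dist_zero_right, Real.norm_eq_abs]
        linarith [not_le.1 ht]
      rw [hχ0, mul_zero]
  · -- non-vanishing at `0`
    have hχ1 : χ 0 = 1 := χ.one_of_mem_closedBall (Metric.mem_closedBall_self (by positivity))
    simp only [hf, hχ1, mul_one]
    exact mul_ne_zero two_ne_zero hpos0.ne'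

/-- Test functions are closed under complex conjugation. -/
theorem isWeilTest_conj {g : ℝ → ℂ} (hg : IsWeilTest g) : IsWeilTest fun t => conj (g t) :=
  ⟨Complex.conjCLE.contDiff.comp hg.1, hg.2.comp_left (g := conj) (map_zero _)⟩

/-- **NV ⇒ RH: a non-null tight weak limit of renormalised ground states gives RH.**  If along
windows `a_k → ∞` there are ground states `u_k` and scalars `c_k` with `c_k u_k` bounded in ONE
weighted `L¹(e^{b₀|t|} dt)`, `b₀ > 1/2`, whose pairings with test functions converge,
`∫ c_k u_k g → Λ(g)`, to a limit functional `Λ` that does not vanish on some test function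
`g₀`, then the Riemann hypothesis holds (no identification of the limit, no simplicity or
evenness of the bottom, no Connes–van Suijlekom, no Hurwitz).  Proof: with `h₀ = conj ∘ g₀`,
eventually `‖∫ c_k u_k h̄₀‖ ≥ ‖Λ g₀‖/2 > 0`, and `riemannHypothesis_of_nondegenerate_tight_groundStates`
applies to the tail of the sequence.  This is card `harmonic-weak-limit-closure`'s "tightness
suffices" in its sharpest form: the RH-content of the line is exactly the NON-VANISHING of a
`b₀ > 1/2`-tight weak limit. -/
theorem riemannHypothesis_of_tight_weakLimit_ne_zero
    (h : ∃ a : ℕ → ℝ, ∃ u : ℕ → ℝ → ℂ, ∃ c : ℕ → ℂ, Tendsto a atTop atTop ∧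
      (∀ k, IsWeilGroundState (a k) (u k)) ∧
      (∃ b₀ : ℝ, 1 / 2 < b₀ ∧ ∃ M : ℝ, ∀ k, ∫ t, ‖c k * u k t‖ * Real.exp (b₀ * |t|) ≤ M) ∧
      ∃ Λ : (ℝ → ℂ) → ℂ, (∀ g : ℝ → ℂ, IsWeilTest g →
        Tendsto (fun k => ∫ t, c k * u k t * g t) atTop (𝓝 (Λ g))) ∧
        ∃ g₀ : ℝ → ℂ, IsWeilTest g₀ ∧ Λ g₀ ≠ 0) :
    RiemannHypothesis := by
  obtain ⟨a, u, c, ha, hu, ⟨b₀, hb₀, M, hM⟩, Λ, hweak, g₀, hg₀, hΛ⟩ := h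
  set h₀ : ℝ → ℂ := fun t => conj (g₀ t) with hh₀def
  have hh₀ : IsWeilTest h₀ := isWeilTest_conj hg₀
  have hPpos : 0 < ‖Λ g₀‖ / 2 := by positivity
  -- eventually the pairings with `conj h₀ = g₀` are at least `‖Λ g₀‖/2`
  have hev : ∀ᶠ k in atTop, ‖Λ g₀‖ / 2 ≤ ‖∫ t, c k * u k t * conj (h₀ t)‖ := by
    have h1 := hweak g₀ hg₀
    rw [Metric.tendsto_nhds] at h1
    filter_upwards [h1 (‖Λ g₀‖ / 2) hPpos] with k hk
    rw [dist_eq_norm] at hk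
    have hconj : (fun t => c k * u k t * conj (h₀ t)) = fun t => c k * u k t * g₀ t := by
      funext t
      simp [hh₀def]
    rw [hconj]
    have := norm_sub_norm_le (Λ g₀) (∫ t, c k * u k t * g₀ t)
    rw [← norm_neg, neg_sub] at hk
    linarith
  obtain ⟨K, hK⟩ := eventually_atTop.1 hev
  -- apply the non-degenerate version to the tail `k ↦ k + K`
  exact riemannHypothesis_of_nondegenerate_tight_groundStates
    ⟨fun k => a (k + K), fun k => u (k + K), fun k => c (k + K),
      ha.comp (tendsto_add_atTop_nat K), fun k => hu (k + K), ⟨b₀, hb₀, M, fun k => hM (k + K)⟩,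
      ⟨h₀, hh₀, ‖Λ g₀‖ / 2, hPpos, fun k => hK (k + K) (Nat.le_add_left K k)⟩⟩

/-- **C⁺⁺ ⇒ RH (formal RH-hardness of the line's load-bearing stub).**  If along windows
`a_k → ∞` there are ground states `u_k` and scalars `c_k` with `c_k u_k` bounded in ONE weighted
`L¹(e^{b₀|t|} dt)`, `b₀ > 1/2`, and converging weakly against smooth compactly supported test
functions to Riemann's kernel `Φ(t) = 2Ψ(2t)`, then the Riemann hypothesis holds: a bump `h₀`
with `∫ Φ h₀ ≠ 0` (`exists_isWeilTest_integral_phi_mul_ne_zero`) eventually has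
`‖⟨c_k u_k, h₀⟩‖ ≥ ‖∫ Φ h₀‖/2 > 0`, and `riemannHypothesis_of_nondegenerate_tight_groundStates`
applies to the tail of the sequence.  (The stub `stub_tightWeakLimit` itself asks tightness
only for `b < 1/2`, which is what the transfer to the crux needs; any proof of it through a
position-space approximation of `u_k` by `Φ` gives the `b₀ > 1/2` bound as well.) -/
theorem riemannHypothesis_of_tightWeakLimit_strong
    (h : ∃ a : ℕ → ℝ, ∃ u : ℕ → ℝ → ℂ, ∃ c : ℕ → ℂ, Tendsto a atTop atTop ∧
      (∀ k, IsWeilGroundState (a k) (u k)) ∧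
      (∃ b₀ : ℝ, 1 / 2 < b₀ ∧ ∃ M : ℝ, ∀ k, ∫ t, ‖c k * u k t‖ * Real.exp (b₀ * |t|) ≤ M) ∧
      (∀ g : ℝ → ℂ, IsWeilTest g →
        Tendsto (fun k => ∫ t, c k * u k t * g t) atTop
          (𝓝 (∫ t, 2 * LagariasMontague.Psic (2 * t) * g t)))) :
    RiemannHypothesis := by
  obtain ⟨a, u, c, ha, hu, htight, hweak⟩ := h
  obtain ⟨h₀, hh₀, -, hP⟩ := exists_isWeilTest_integral_phi_mul_ne_zero
  exact riemannHypothesis_of_tight_weakLimit_ne_zero ⟨a, u, c, ha, hu, htight,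
    fun g => ∫ t, 2 * LagariasMontague.Psic (2 * t) * g t, hweak, h₀, hh₀, hP⟩

end Summit.RiemannHypothesis.RiemannHypothesis.Theorems.GroundStatesConvergeToXi

end
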